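import Summits.MatrixMultiplication.OmegaCensus.STPPDifferenceSetCriterion
import Mathlib.Data.Finset.Card

/-!
# ω-census, small STPP patterns `(2,1,1)^k` and `(1,2,2)^k`: the engines' models ARE Def. 5.1 (kernel criteria)

HONEST FRAMING (pub-omega census; verbatim): lottery ticket; floor = certified bounds/negative ranges.
Census STRUCTURE tool of the STPP track (seat pub-omega-stpp-3, gen 22), not progress on `ω`.

The mixed block-product law (`STPPMixedProducts.lean`) turns a `(2,1,1)^k` family in `H` into a `(2,2,2)^k` family in `ℤ/4 × H`,
`(ℤ/2)² × H`, `ℤ/5 × H`, and a `(1,2,2)^k` family into one in `ℤ/2 × H`, `ℤ/3 × H`; the census therefore decides the small patterns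
in small groups by COMPLETE listers (`gen211.c` / `desc122.c` of gen 21, kit j289336 = row Pb213; the code-disjoint second lister
`lister2.c` of gen 22 = rows Pb213 ×2 / Pb214).  Those engines do not search Def. 5.1 literally; they search a DIFFERENCE MODEL.  This
file puts into the kernel that the models are exactly Def. 5.1 (tree `IsSTPP`), so that an engine's exhaustive NONE over its model is a
NONE for the pattern:

* the normal forms `Bᵢ = {0}` resp. `Aᵢ = {0}` come from the tree's per-triple translation invariance `isSTPP_translate`
  (`STPPDifferenceSetCriterion.lean`, seat stpp-2);
* `isSTPP_pairPoint_iff` — for pairs `Aᵢ = {pᵢ, qᵢ}`, `Bᵢ = {0}`, points `Cᵢ = {cᵢ}`: STPP ⟺ the pairs are pairwise disjoint AND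
  `x − y ≠ cⱼ − c_l` for all `x ∈ Aᵢ`, `y ∈ A_l`, `j ≠ l` (i.e. `cⱼ − c_l ∉ ⋃ᵢ Aᵢ − A_l`) — the model of `lister2.c`;
* `exists_isSTPP_211_iff` — `H` hosts the size pattern `(2,1,1)^k` iff some `p q c : Fin k → H` with `pᵢ ≠ qᵢ` satisfy that criterion;
* `isSTPP_pointPairs_iff`, `exists_isSTPP_122_iff` — the same for `(1,2,2)^k` (`Aᵢ = {0}`, pairs `Bᵢ`, `Cᵢ`): STPP ⟺ the four
  differences `t' − u` (`t' ∈ Bⱼ`, `u ∈ Cⱼ`) are pairwise distinct for each `j` AND `t' − u ≠ t − u'` whenever `t ∈ Bᵢ`, `u' ∈ C_l`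
  with `(i, l) ≠ (j, j)` — the model of `desc122.c`.

No threshold or existence claim is made here.  References: H. Cohn, R. Kleinberg, B. Szegedy, C. Umans, *Group-theoretic algorithms for
matrix multiplication*, FOCS 2005 (arXiv:math/0511460), Def. 5.1.
-/

namespace Summit.MatrixMultiplication.OmegaCensus

open Finset Pointwise Literature.Computability.AlgebraicComplexity

variable {H : Type*} [AddCommGroup H] {k : ℕ}


section PairPoint

variable [DecidableEq H]

/-- Translate of a pair (pointwise sum with a singleton). [folklore] -/
theorem pair_add_singleton (x y g : H) : ({x, y} : Finset H) + {g} = {x + g, y + g} := by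
  rw [insert_eq, union_add, singleton_add_singleton, singleton_add_singleton, ← insert_eq]

/-- **The `(2,1,1)` difference model is Def. 5.1.** For pairs-or-points `Aᵢ = {pᵢ, qᵢ}`, `Bᵢ = {0}` and points `Cᵢ = {cᵢ}`, the family
satisfies CKSU Def. 5.1 iff (i) `Aᵢ` and `A_l` are disjoint for `i ≠ l`, and (ii) `x − y ≠ cⱼ − c_l` for all `x ∈ Aᵢ`, `y ∈ A_l` and all
`j ≠ l` (any `i`, including `i = l`).  (With `t = t' = 0`, `u = cⱼ`, `u' = c_l` the defining word is `(s' − s) + (c_l − cⱼ)`.)  No hypothesis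
`pᵢ ≠ qᵢ` is needed for the equivalence. [cite: CohnKleinbergSzegedyUmans2005, Def. 5.1] -/
theorem isSTPP_pairPoint_iff (p q c : Fin k → H) :
    IsSTPP (fun i => ({p i, q i} : Finset H)) (fun _ => ({0} : Finset H)) (fun i => ({c i} : Finset H)) ↔
      (∀ i l : Fin k, i ≠ l → Disjoint ({p i, q i} : Finset H) {p l, q l}) ∧
      (∀ i j l : Fin k, j ≠ l → ∀ x ∈ ({p i, q i} : Finset H), ∀ y ∈ ({p l, q l} : Finset H), x - y ≠ c j - c l) := by
  constructor
  · intro hS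
    refine ⟨fun i l hil => ?_, fun i j l hjl x hx y hy hxy => ?_⟩
    · rw [Finset.disjoint_left]
      intro x hxi hxl
      have e : (x - x) + ((0 : H) - 0) + (c l - c l) = 0 := by simp only [sub_self, add_zero]
      obtain ⟨h1, -, -⟩ := hS i l l x hxl x hxi 0 (mem_singleton_self _) 0 (mem_singleton_self _) (c l)
        (mem_singleton_self _) (c l) (mem_singleton_self _) e
      exact hil h1
    · have e : (x - y) + ((0 : H) - 0) + (c l - c j) = 0 := by rw [hxy]; abel
      obtain ⟨-, h2, -⟩ := hS i j l y hy x hx 0 (mem_singleton_self _) 0 (mem_singleton_self _) (c j)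
        (mem_singleton_self _) (c l) (mem_singleton_self _) e
      exact hjl h2
  · rintro ⟨hD, hX⟩ i j l s hs s' hs' t ht t' ht' u hu u' hu' h0
    rw [mem_singleton] at ht ht' hu hu'
    subst ht ht' hu hu'
    have hxy : s' - s = c j - c l := by
      have h1 : (s' - s) + (c l - c j) = 0 := by simpa only [sub_self, add_zero] using h0
      rw [add_eq_zero_iff_eq_neg, neg_sub] at h1
      exact h1
    by_cases hjl : j = l
    · subst hjl
      have hss : s' = s := by
        rw [sub_self] at hxy
        exact sub_eq_zero.mp hxy
      subst hss
      by_cases hij : i = j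
      · subst hij
        exact ⟨rfl, rfl, rfl, rfl, rfl⟩
      · exact absurd hs (Finset.disjoint_left.mp (hD i j hij) hs')
    · exact absurd hxy (hX i j l hjl s' hs' s hs)

/-- **`H` hosts the size pattern `(2,1,1)^k` iff the `(2,1,1)` difference model has a solution**: some `p q c : Fin k → H` with
`pᵢ ≠ qᵢ`, the pairs `{pᵢ, qᵢ}` pairwise disjoint, and `x − y ≠ cⱼ − c_l` for all `x ∈ {pᵢ,qᵢ}`, `y ∈ {p_l,q_l}`, `j ≠ l`.  (`→`: write
`Bᵢ = {bᵢ}` and translate the `i`-th triple by `−bᵢ`, tree `isSTPP_translate`; `←`: the family `({pᵢ,qᵢ}, {0}, {cᵢ})`.)  This is the statement the complete listers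
of the census decide (rows Pb213/Pb214). [cite: CohnKleinbergSzegedyUmans2005, Def. 5.1] -/
theorem exists_isSTPP_211_iff :
    (∃ A B C : Fin k → Finset H, IsSTPP A B C ∧ ∀ i, (A i).card = 2 ∧ (B i).card = 1 ∧ (C i).card = 1) ↔
      ∃ p q c : Fin k → H, (∀ i, p i ≠ q i) ∧
        (∀ i l : Fin k, i ≠ l → Disjoint ({p i, q i} : Finset H) {p l, q l}) ∧
        (∀ i j l : Fin k, j ≠ l → ∀ x ∈ ({p i, q i} : Finset H), ∀ y ∈ ({p l, q l} : Finset H), x - y ≠ c j - c l) := by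
  constructor
  · rintro ⟨A, B, C, hS, hc⟩
    have hA : ∀ i, ∃ x y : H, x ≠ y ∧ A i = {x, y} := fun i => card_eq_two.mp (hc i).1
    have hB : ∀ i, ∃ b : H, B i = {b} := fun i => card_eq_one.mp (hc i).2.1
    have hC : ∀ i, ∃ d : H, C i = {d} := fun i => card_eq_one.mp (hc i).2.2
    choose p' q' hpq hA' using hA
    choose b hB' using hB
    choose d hC' using hC
    have hT := isSTPP_translate hS (fun i => -b i) 0 0
    have eA : (fun i => A i + ({-b i} : Finset H)) = fun i => ({p' i + -b i, q' i + -b i} : Finset H) := by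
      funext i; rw [hA' i, pair_add_singleton]
    have eB : (fun i => B i + ({-b i + 0} : Finset H)) = fun _ => ({0} : Finset H) := by
      funext i; rw [hB' i, add_zero, singleton_add_singleton, add_neg_cancel]
    have eC : (fun i => C i + ({-b i + 0} : Finset H)) = fun i => ({d i + -b i} : Finset H) := by
      funext i; rw [hC' i, add_zero, singleton_add_singleton]
    rw [eA, eB, eC] at hT
    refine ⟨fun i => p' i + -b i, fun i => q' i + -b i, fun i => d i + -b i, fun i h => hpq i ?_,
      (isSTPP_pairPoint_iff _ _ _).mp hT⟩
    exact add_right_cancel h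
  · rintro ⟨p, q, c, hpq, hD, hX⟩
    exact ⟨fun i => {p i, q i}, fun _ => {0}, fun i => {c i}, (isSTPP_pairPoint_iff p q c).mpr ⟨hD, hX⟩,
      fun i => ⟨card_pair (hpq i), card_singleton _, card_singleton _⟩⟩

end PairPoint

section PointPairs

variable [DecidableEq H]

/-- **The `(1,2,2)` difference model is Def. 5.1.** For `Aᵢ = {0}` and pairs-or-points `Bᵢ = {bᵢ, b'ᵢ}`, `Cᵢ = {cᵢ, c'ᵢ}`, the family
satisfies CKSU Def. 5.1 iff (i) for each `j` a coincidence `t' − u = t − u'` among differences `Bⱼ − Cⱼ` forces `t = t'`, `u = u'` (the four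
differences are pairwise distinct), and (ii) `t' − u ≠ t − u'` whenever `t' ∈ Bⱼ`, `u ∈ Cⱼ`, `t ∈ Bᵢ`, `u' ∈ C_l` with `(i, l) ≠ (j, j)`.
(With `s = s' = 0` the defining word is `(t' − t) + (u' − u) = (t' − u) − (t − u')`.) [cite: CohnKleinbergSzegedyUmans2005, Def. 5.1] -/
theorem isSTPP_pointPairs_iff (b b' c c' : Fin k → H) :
    IsSTPP (fun _ => ({0} : Finset H)) (fun i => ({b i, b' i} : Finset H)) (fun i => ({c i, c' i} : Finset H)) ↔
      (∀ j : Fin k, ∀ t ∈ ({b j, b' j} : Finset H), ∀ t' ∈ ({b j, b' j} : Finset H),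
          ∀ u ∈ ({c j, c' j} : Finset H), ∀ u' ∈ ({c j, c' j} : Finset H), t' - u = t - u' → t = t' ∧ u = u') ∧
      (∀ i j l : Fin k, (i ≠ j ∨ l ≠ j) → ∀ t ∈ ({b i, b' i} : Finset H), ∀ t' ∈ ({b j, b' j} : Finset H),
          ∀ u ∈ ({c j, c' j} : Finset H), ∀ u' ∈ ({c l, c' l} : Finset H), t' - u ≠ t - u') := by
  have word : ∀ t t' u u' : H, ((0 : H) - 0) + (t' - t) + (u' - u) = 0 ↔ t' - u = t - u' := by
    intro t t' u u'
    have : ((0 : H) - 0) + (t' - t) + (u' - u) = (t' - u) - (t - u') := by abel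
    rw [this, sub_eq_zero]
  constructor
  · intro hS
    refine ⟨fun j t ht t' ht' u hu u' hu' h => ?_, fun i j l hne t ht t' ht' u hu u' hu' h => ?_⟩
    · obtain ⟨-, -, -, h4, h5⟩ := hS j j j 0 (mem_singleton_self _) 0 (mem_singleton_self _) t ht t' ht' u hu u' hu'
        ((word t t' u u').mpr h)
      exact ⟨h4, h5⟩
    · obtain ⟨h1, h2, -⟩ := hS i j l 0 (mem_singleton_self _) 0 (mem_singleton_self _) t ht t' ht' u hu u' hu'
        ((word t t' u u').mpr h)
      rcases hne with hne | hne
      · exact hne h1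
      · exact hne h2.symm
  · rintro ⟨hU, hX⟩ i j l s hs s' hs' t ht t' ht' u hu u' hu' h0
    rw [mem_singleton] at hs hs'
    subst hs hs'
    have h := (word t t' u u').mp h0
    by_cases hij : i = j
    · by_cases hlj : l = j
      · subst hij; subst hlj
        obtain ⟨h4, h5⟩ := hU _ t ht t' ht' u hu u' hu' h
        exact ⟨rfl, rfl, rfl, h4, h5⟩
      · exact absurd h (hX i j l (Or.inr hlj) t ht t' ht' u hu u' hu')
    · exact absurd h (hX i j l (Or.inl hij) t ht t' ht' u hu u' hu')

/-- **`H` hosts the size pattern `(1,2,2)^k` iff the `(1,2,2)` difference model has a solution** (`→`: write `Aᵢ = {aᵢ}` and translate the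
`i`-th triple by `−aᵢ`; `←`: the family `({0}, {bᵢ,b'ᵢ}, {cᵢ,c'ᵢ})`).  This is the statement the `(1,2,2)` lister of the census decides.
[cite: CohnKleinbergSzegedyUmans2005, Def. 5.1] -/
theorem exists_isSTPP_122_iff :
    (∃ A B C : Fin k → Finset H, IsSTPP A B C ∧ ∀ i, (A i).card = 1 ∧ (B i).card = 2 ∧ (C i).card = 2) ↔
      ∃ b b' c c' : Fin k → H, (∀ i, b i ≠ b' i) ∧ (∀ i, c i ≠ c' i) ∧
        (∀ j : Fin k, ∀ t ∈ ({b j, b' j} : Finset H), ∀ t' ∈ ({b j, b' j} : Finset H),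
            ∀ u ∈ ({c j, c' j} : Finset H), ∀ u' ∈ ({c j, c' j} : Finset H), t' - u = t - u' → t = t' ∧ u = u') ∧
        (∀ i j l : Fin k, (i ≠ j ∨ l ≠ j) → ∀ t ∈ ({b i, b' i} : Finset H), ∀ t' ∈ ({b j, b' j} : Finset H),
            ∀ u ∈ ({c j, c' j} : Finset H), ∀ u' ∈ ({c l, c' l} : Finset H), t' - u ≠ t - u') := by
  constructor
  · rintro ⟨A, B, C, hS, hc⟩
    have hA : ∀ i, ∃ a : H, A i = {a} := fun i => card_eq_one.mp (hc i).1
    have hB : ∀ i, ∃ x y : H, x ≠ y ∧ B i = {x, y} := fun i => card_eq_two.mp (hc i).2.1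
    have hC : ∀ i, ∃ x y : H, x ≠ y ∧ C i = {x, y} := fun i => card_eq_two.mp (hc i).2.2
    choose a hA' using hA
    choose x y hxy hB' using hB
    choose z w hzw hC' using hC
    have hT := isSTPP_translate hS (fun i => -a i) 0 0
    have eA : (fun i => A i + ({-a i} : Finset H)) = fun _ => ({0} : Finset H) := by
      funext i; rw [hA' i, singleton_add_singleton, add_neg_cancel]
    have eB : (fun i => B i + ({-a i + 0} : Finset H)) = fun i => ({x i + -a i, y i + -a i} : Finset H) := by
      funext i; rw [hB' i, add_zero, pair_add_singleton]
    have eC : (fun i => C i + ({-a i + 0} : Finset H)) = fun i => ({z i + -a i, w i + -a i} : Finset H) := by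
      funext i; rw [hC' i, add_zero, pair_add_singleton]
    rw [eA, eB, eC] at hT
    obtain ⟨hU, hX⟩ := (isSTPP_pointPairs_iff _ _ _ _).mp hT
    exact ⟨fun i => x i + -a i, fun i => y i + -a i, fun i => z i + -a i, fun i => w i + -a i,
      fun i h => hxy i (add_right_cancel h), fun i h => hzw i (add_right_cancel h), hU, hX⟩
  · rintro ⟨b, b', c, c', hb, hc, hU, hX⟩
    exact ⟨fun _ => {0}, fun i => {b i, b' i}, fun i => {c i, c' i}, (isSTPP_pointPairs_iff b b' c c').mpr ⟨hU, hX⟩,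
      fun i => ⟨card_singleton _, card_pair (hb i), card_pair (hc i)⟩⟩

end PointPairs

end Summit.MatrixMultiplication.OmegaCensus
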